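import Summits.AtomisticToContinuum.FouriersLaw.Theorems.BondHeatUncertaintyBoundedResponseBathHeatSeparation
import Summits.AtomisticToContinuum.FouriersLaw.Theorems.BondHeatUncertaintyBoundedResponseTailSign
import Literature.Analysis.FunctionSpaces.L2ValuedPathDeriv
import HarnessLib

/-!
# BondHeatUncertainty / BoundedResponse — «OwedHeat» §1–§2: the objects OWED HEAT `𝒯_N(v) = ∫_{(v,∞)} K_N`, KICK-RESOLVED OWED HEAT
`𝔗^v_N(k) = ∫_{(v,∞)} (Ḡ_{N,u}(k) − T) du`, LATE OVERSHOOT `𝒪_N(s,t) = ∫ₛᵗ 𝒯_N⁻`, and the generic real-variable layer cakes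
(decomp-a2c lens-1, g115, NODE 115 «OwedHeat»; part 1 of 4; the route statements with their tags and failure modes are in part C, the overview
and barriers in the main file `…BathHeatOwedHeat`; chain A → B → C → main; this file imports only the tree: NODE 114 `…BathHeatSeparation`, g97 `…TailSign`,
`Literature.Analysis.FunctionSpaces.L2ValuedPathDeriv`, + `HarnessLib`)

For a measurable `g` integrable on `(0,∞)` (§2): `∫_{(v,∞)} g = ∫_{(0,∞)} g − ∫₀ᵛ g`; continuity and interval-integrability of the tail `v ↦ ∫_{(v,∞)} g`;
`∫_{(0,∞)} min(u,t)·g = ∫₀ᵗ (∫_{(v,∞)} g) dv` (the tree's layer cake `intervalIntegral_integral_Ioi_eq_integral_min_mul`, re-oriented);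
`∫ min(u,t₂)g − ∫ min(u,t₁)g = ∫_{t₁}^{t₂} ∫_{(v,∞)} g`; ★ THE LATE LAYER CAKE `∫_{(0,∞)} ℓ_{s,t}(u)·g(u) du = ∫_{2s}^{t} (∫_{(v,∞)} g) dv + 2∫_{s}^{2s} (∫_{(v,∞)} g) dv`
for NODE 109's late weight `ℓ_{s,t} = min(·,t) − 2min(·,s) + min(·,2s)` (`0 ≤ s`, `2s ≤ t`); a tail bound for nonnegative kernels; `eventually_lateWindow`
(eventually `N ≥ N₀`, `N ≥ 1`, `q·a·N ≤ c·N²`). No `sorry`, no new axioms; nothing here is a route statement.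
-/

noncomputable section

open MeasureTheory ProbabilityTheory Filter Topology Set Function
open scoped NNReal ENNReal
open Literature.MathematicalPhysics.KineticTheory.HeatConduction
open Literature.MathematicalPhysics.KineticTheory OscillatorChain
open Literature.Probability.Process
open Summit.AtomisticToContinuum.FouriersLaw.Theorems.SubdiffusiveBondHeat
open Summit.AtomisticToContinuum.FouriersLaw.Theorems.SubdiffusiveBondHeat.EscapeGrading
open Summit.AtomisticToContinuum.FouriersLaw.Theorems.BoundedResponse.TransientBand
open Summit.AtomisticToContinuum.FouriersLaw.Theorems.BoundedResponse.ParityFloor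
  (kinObs kinAct continuous_kinObs stronglyMeasurable_kinAct abs_kinAct_le harrisBound_exists weight_facts
    oneSub_stepResponse_sub_escapeDeficit_eq_returnTail)
open Summit.AtomisticToContinuum.FouriersLaw.Theorems.OddSectorIrreversibility (pinnedChain_stronglyMeasurable_act_uncurry)

namespace Summit.AtomisticToContinuum.FouriersLaw.Theorems.BoundedResponse.HeatSpreading

open Summit.AtomisticToContinuum.FouriersLaw.Theses.BondHeatUncertainty (BoundedResponse SubdiffusiveBondHeat)

/-! ## §1 The objects: owed heat, kick-resolved owed heat, late overshoot -/

/-- **OWED HEAT `𝒯_N(v) := ∫_{(v,∞)} K_N(r) dr`** — the heat the chain still owes the contact after lag `v`: in response units the REMAINING RISE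
of the contact step response, `(γ/T²)·𝒯_N(v) = θ_N(∞) − θ_N(v)` (`owedHeat_eq_stepResponse_gap`), and `γ²·𝒯_N = B_N'` (`bathTail_sub_eq`). The
g97 «return tail» `R_N = (γ/T²)𝒯_N` written on `escapeKernel = bathKinCorr`. [formal bookkeeping] -/
def owedHeat (ω₂ lam β γ T : ℝ) (N : ℕ) (v : ℝ) : ℝ :=
  ∫ r in Ioi v, bathKinCorr ω₂ lam β γ T N r

/-- **KICK-RESOLVED OWED HEAT `𝔗^v_N(k) := ∫_{(v,∞)} (Ḡ_{N,u}(k) − T) du`** — the excess contact kinetic energy still to be returned after lag `v`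
following a boundary kick of momentum `k` (NODE 110's energy-response curve `Ḡ_{N,u}(k) = kinKickProfile`, integrated over the lags BEYOND `v`;
informally the kick forecast of the Kubo corrector). Its thermal pairing `∫ (k² − T)·𝔗^v_N(k) dν_T(k)` should be `𝒯_N(v)` (kick × time Fubini
as in NODE 111 — NOT proved here and not needed: the doors below pair the HORIZON INCREMENTS instead). [formal bookkeeping] -/
def owedHeatKick (ω₂ lam β γ T : ℝ) (N : ℕ) (v k : ℝ) : ℝ :=
  ∫ u in Ioi v, (kinKickProfile ω₂ lam β γ T N u k - T)

/-- **LATE OVERSHOOT `𝒪_N(s,t) := ∫ₛᵗ 𝒯_N(v)⁻ dv`** (`x⁻ = max(−x,0)`) — the integrated amount by which the contact step response OVERSHOOTS its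
final value on the lag window `[s,t]`, in kernel units. [formal bookkeeping] -/
def lateOvershoot (ω₂ lam β γ T : ℝ) (N : ℕ) (s t : ℝ) : ℝ :=
  ∫ v in s..t, max (-(owedHeat ω₂ lam β γ T N v)) 0

/-! ## §2 Real-variable layer cakes (generic: a measurable kernel integrable on `(0,∞)`) -/

section Generic

variable {g : ℝ → ℝ}

/-- Splitting the tail: `∫_{(v,∞)} g = ∫_{(0,∞)} g − ∫₀ᵛ g` for `v ≥ 0`. [formal bookkeeping] -/
theorem setIntegral_Ioi_eq_sub_intervalIntegral (hgi : IntegrableOn g (Ioi 0)) {v : ℝ} (hv : 0 ≤ v) :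
    ∫ u in Ioi v, g u = (∫ u in Ioi 0, g u) - ∫ u in (0:ℝ)..v, g u := by
  rw [intervalIntegral.integral_of_le hv, ← Ioc_union_Ioi_eq_Ioi hv,
    setIntegral_union Ioc_disjoint_Ioi_same measurableSet_Ioi (hgi.mono_set Ioc_subset_Ioi_self)
      (hgi.mono_set (Ioi_subset_Ioi hv))]
  ring

/-- The tail `v ↦ ∫_{(v,∞)} g` is continuous on `[0, t]` (primitive of an integrable function). [folklore] -/
theorem continuousOn_setIntegral_Ioi (hgi : IntegrableOn g (Ioi 0)) {t : ℝ} (ht : 0 ≤ t) :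
    ContinuousOn (fun v => ∫ u in Ioi v, g u) (Icc 0 t) := by
  have hIcc : IntegrableOn g (uIcc 0 t) volume := by
    rw [uIcc_of_le ht, integrableOn_Icc_iff_integrableOn_Ioc]
    exact hgi.mono_set Ioc_subset_Ioi_self
  have h1 := intervalIntegral.continuousOn_primitive_interval hIcc
  rw [uIcc_of_le ht] at h1
  exact (continuousOn_const.sub h1).congr (fun v hv => setIntegral_Ioi_eq_sub_intervalIntegral hgi hv.1)

/-- Interval integrability of the tail on sub-intervals of `[0, t]`. [formal bookkeeping] -/
theorem intervalIntegrable_setIntegral_Ioi (hgi : IntegrableOn g (Ioi 0)) {a b t : ℝ} (ha : 0 ≤ a) (hab : a ≤ b) (hbt : b ≤ t) :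
    IntervalIntegrable (fun v => ∫ u in Ioi v, g u) volume a b :=
  ((continuousOn_setIntegral_Ioi hgi (ha.trans (hab.trans hbt))).mono (Icc_subset_Icc_right hbt) |>.mono
    (Icc_subset_Icc_left ha)).intervalIntegrable_of_Icc hab

/-- `min(u,τ)·g(u)` is integrable on `(0,∞)` for `τ ≥ 0`. [formal bookkeeping] -/
theorem integrableOn_min_mul (hgm : Measurable g) (hgi : IntegrableOn g (Ioi 0)) {τ : ℝ} (hτ : 0 ≤ τ) :
    IntegrableOn (fun u => min u τ * g u) (Ioi 0) := by
  refine Integrable.mono' (hgi.norm.const_mul τ)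
    (((continuous_id.min continuous_const).measurable.mul hgm).aestronglyMeasurable) ?_
  filter_upwards [ae_restrict_mem measurableSet_Ioi] with u hu
  rw [norm_mul, Real.norm_eq_abs, abs_of_nonneg (le_min (le_of_lt (show (0:ℝ) < u from hu)) hτ)]
  exact mul_le_mul_of_nonneg_right (min_le_right _ _) (norm_nonneg _)

/-- ★ **LAYER CAKE** (the tree's `intervalIntegral_integral_Ioi_eq_integral_min_mul`, restated): `∫_{(0,∞)} min(u,τ) g(u) du = ∫₀^τ (∫_{(v,∞)} g) dv`.
[folklore] -/
theorem integral_min_mul_eq_intervalIntegral_tail (hgm : Measurable g) (hgi : IntegrableOn g (Ioi 0)) {τ : ℝ} (hτ : 0 ≤ τ) :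
    ∫ u in Ioi 0, min u τ * g u = ∫ v in (0:ℝ)..τ, ∫ u in Ioi v, g u :=
  (intervalIntegral_integral_Ioi_eq_integral_min_mul hgm hgi hτ).symm

/-- ★ **HORIZON INCREMENT**: `∫_{(0,∞)} (min(u,t₂) − min(u,t₁)) g = ∫_{t₁}^{t₂} (∫_{(v,∞)} g) dv` for `0 ≤ t₁ ≤ t₂`. [folklore] -/
theorem integral_min_sub_min_mul_eq (hgm : Measurable g) (hgi : IntegrableOn g (Ioi 0)) {t₁ t₂ : ℝ} (h1 : 0 ≤ t₁) (h12 : t₁ ≤ t₂) :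
    (∫ u in Ioi 0, min u t₂ * g u) - ∫ u in Ioi 0, min u t₁ * g u = ∫ v in t₁..t₂, ∫ u in Ioi v, g u := by
  rw [integral_min_mul_eq_intervalIntegral_tail hgm hgi (h1.trans h12), integral_min_mul_eq_intervalIntegral_tail hgm hgi h1,
    intervalIntegral.integral_interval_sub_left
      (intervalIntegrable_setIntegral_Ioi hgi le_rfl (h1.trans h12) le_rfl)
      (intervalIntegrable_setIntegral_Ioi hgi le_rfl h1 h12)]

/-- ★★ **LATE LAYER CAKE**: for `0 ≤ s`, `2s ≤ t`,
`∫_{(0,∞)} ℓ_{s,t}(u) g(u) du = ∫_{2s}^{t} (∫_{(v,∞)} g) dv + 2·∫_{s}^{2s} (∫_{(v,∞)} g) dv`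
(`ℓ_{s,t} = min(·,t) − 2min(·,s) + min(·,2s)`, NODE 109): the late functional weighs the TAIL-CUMULATIVE response with density `1` on `[2s,t]` and
`2` on `[s,2s]`, and nothing before the light cone. [this cell] -/
theorem integral_lateWeight_mul_eq (hgm : Measurable g) (hgi : IntegrableOn g (Ioi 0)) {s t : ℝ} (hs : 0 ≤ s) (hst : 2 * s ≤ t) :
    ∫ u in Ioi 0, lateWeight s t u * g u =
      (∫ v in (2 * s)..t, ∫ u in Ioi v, g u) + 2 * ∫ v in s..(2 * s), ∫ u in Ioi v, g u := by
  have ht : 0 ≤ t := by linarith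
  have h2s : 0 ≤ 2 * s := by positivity
  have hs2 : s ≤ 2 * s := by linarith
  have hm := fun {τ : ℝ} (hτ : 0 ≤ τ) => integrableOn_min_mul hgm hgi hτ
  have e : (fun u => lateWeight s t u * g u) = fun u => min u t * g u - (2 * (min u s * g u) - min u (2 * s) * g u) := by
    funext u; simp only [lateWeight]; ring
  have hX : Integrable (fun u : ℝ => 2 * (min u s * g u) - min u (2 * s) * g u) (volume.restrict (Ioi (0:ℝ))) :=
    ((hm hs).const_mul 2).sub (hm h2s)
  rw [e, integral_sub (hm ht) hX, integral_sub ((hm hs).const_mul 2) (hm h2s), integral_const_mul]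
  have hA := integral_min_sub_min_mul_eq hgm hgi h2s hst
  have hB := integral_min_sub_min_mul_eq hgm hgi hs hs2
  linarith

/-- **Tail monotonicity in the set**: on `(s,∞)` with `0 ≤ s ≤ t`, `(min(u,t) − min(u,s))·p(u) ≤ min(u,t)·p(u)` for `p ≥ 0`, and the weight
vanishes on `(0,s]`; hence `∫_{s}^{t} (∫_{(v,∞)} p) dv ≤ ∫_{(s,∞)} min(u,t) p(u) du`. [formal bookkeeping] -/
theorem intervalIntegral_tail_le_integral_min_mul (hgm : Measurable g) (hgi : IntegrableOn g (Ioi 0)) (hg0 : ∀ u, 0 ≤ g u)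
    {s t : ℝ} (hs : 0 ≤ s) (hst : s ≤ t) :
    ∫ v in s..t, ∫ u in Ioi v, g u ≤ ∫ u in Ioi s, min u t * g u := by
  have ht : 0 ≤ t := hs.trans hst
  rw [← integral_min_sub_min_mul_eq hgm hgi hs hst, ← integral_sub (integrableOn_min_mul hgm hgi ht) (integrableOn_min_mul hgm hgi hs)]
  have hI : IntegrableOn (fun u => min u t * g u - min u s * g u) (Ioi 0) :=
    (integrableOn_min_mul hgm hgi ht).sub (integrableOn_min_mul hgm hgi hs)
  -- split `(0,∞) = (0,s] ∪ (s,∞)`; the first piece vanishes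
  have hsplit : ∫ u in Ioi (0:ℝ), (min u t * g u - min u s * g u) =
      (∫ u in Ioc (0:ℝ) s, (min u t * g u - min u s * g u)) + ∫ u in Ioi s, (min u t * g u - min u s * g u) := by
    rw [← Ioc_union_Ioi_eq_Ioi hs]
    exact setIntegral_union Ioc_disjoint_Ioi_same measurableSet_Ioi (hI.mono_set Ioc_subset_Ioi_self) (hI.mono_set (Ioi_subset_Ioi hs))
  have hzero : ∫ u in Ioc (0:ℝ) s, (min u t * g u - min u s * g u) = 0 := by
    rw [setIntegral_congr_fun measurableSet_Ioc (fun u hu => by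
      show min u t * g u - min u s * g u = (0:ℝ)
      rw [min_eq_left hu.2, min_eq_left (hu.2.trans hst), sub_self] : EqOn _ (fun _ => (0:ℝ)) _), integral_zero]
  rw [hsplit, hzero, zero_add]
  refine setIntegral_mono_on (hI.mono_set (Ioi_subset_Ioi hs)) ((integrableOn_min_mul hgm hgi ht).mono_set (Ioi_subset_Ioi hs))
    measurableSet_Ioi (fun u hu => ?_)
  have hus : s ≤ u := le_of_lt (show s < u from hu)
  rw [min_eq_right hus]
  nlinarith [hg0 u]

/-- Eventually `N ≥ 1` and `q·a·N ≤ c·N²` (the window fits under the Thouless horizon). [formal bookkeeping] -/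
theorem eventually_lateWindow {a c q : ℝ} (hc : 0 < c) (N₀ : ℕ) :
    ∃ N₁ : ℕ, ∀ N : ℕ, N₁ ≤ N → N₀ ≤ N ∧ 1 ≤ N ∧ q * a * (N : ℝ) ≤ c * (N : ℝ) ^ 2 := by
  refine ⟨max N₀ (max 1 (Nat.ceil (q * a / c))), fun N hN => ?_⟩
  have hNN₀ : N₀ ≤ N := le_trans (le_max_left _ _) hN
  have hN1 : 1 ≤ N := le_trans (le_max_left _ _) (le_trans (le_max_right _ _) hN)
  have hNc : Nat.ceil (q * a / c) ≤ N := le_trans (le_max_right _ _) (le_trans (le_max_right _ _) hN)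
  have hNpos : (0:ℝ) < N := by exact_mod_cast hN1
  have h2a : q * a / c ≤ (N : ℝ) := le_trans (Nat.le_ceil _) (by exact_mod_cast hNc)
  refine ⟨hNN₀, hN1, ?_⟩
  rw [div_le_iff₀ hc] at h2a
  nlinarith

end Generic

end Summit.AtomisticToContinuum.FouriersLaw.Theorems.BoundedResponse.HeatSpreading

end
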